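import Summits.HodgeConjecture.HodgeConjecture.Theorems.H413E2SWEisDecomposition
import Literature.NumberTheory.Weil1965.AdelicSiegelMeasureIntegral
import HarnessLib

/-!
# H413 · E-2 · SW2 — (E-DEC) UNCONDITIONALLY for a totally real `F`: temperedness and summability discharged

Crux `stmt-HodgeConjecture-24833`; child line `Cruxes/H413/Lines/F0_E2SiegelWeilWeilRange.lean`, `stub_SW2iii_siegelWeil`; letter (E-DEC) of the
I-CLOSE assembly sheet (`F0/P4/F0P2a-p08/SW2-ICLOSE-ASSEMBLY.v0` c78afe1b §1).  No stub is closed here.  KERNEL MATHEMATICS ONLY (theorems;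
no definition, no `sorry`).  Sequel of ★ `Theorems/H413E2SWEisDecomposition` (B-p02 (g18): `E(Ψ) = Ψ♮(0) + Σ'_{b ∈ F} ∫ Ψ♮ dμ_b` under
THREE analytic hypotheses — `hB` (Weil's condition (B) for `h = q_{C₀}`), `htemp` (temperedness of `E_X`: `∫ Ψ dν₀ = E_X Ψ` on `𝒮_ℝ`) and
`hsum` (summable Eisenstein section)) and of the Literature chain ★ `Weil1965/AdelicSiegelCoeffHeightBound` (A-p08 (g17): condition (B)
for `q_S`, `S` symmetric, `det S ≠ 0`, `4 < m`, `F` totally real) · ★ `Weil1965/AdelicSiegelFunctionalCutoffContinuity` +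
★ `Weil1965/AdelicSiegelMeasureIntegral` (F0P4-p06 (g3): `E_X` IS its measure on all of `𝒮_ℝ`, from the family-uniform (B) along tensor
cut-offs).  For a TOTALLY REAL `F` (the child's CM letters carry `[IsTotallyReal F]`) all three hypotheses are THEOREMS at
`h = q_{C₀}`, `C₀ = reindex (𝕋_F ⊕ −d 𝕋_F⁻¹)` (`𝕋_F = gram F e TV TW` symmetric with unit determinant, `d ≠ 0`, `m = n + n = 2N > 4 ⇔ N > 2`):

* §1 `isSymm_C0`, `det_C0_ne_zero`, `four_lt_card` — the matrix bookkeeping;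
* §2 `hB_C0` — condition (B) for `q_{C₀}` on `𝒮(X□)` (★ `summable_norm_adelicSiegelCoeff_sdForm`); `htemp_C0` — temperedness of `E_X` for
  `q_{C₀}` (★ `integral_adelicSiegelMeasure_sdForm_eq_of_mem`), for ANY proof `hB` of (B); `summable_eisSection_of_isTotallyReal` — `hsum` from (B)
  (★ `E2SWEisFourierSide.summable_eisSection_iff_summable_siegelCoeff`);
* §3 **`eis_eq_geomFrame_zero_add_tsum_integral_fibre_of_isTotallyReal`**, **`hasSum_integral_fibre_of_isTotallyReal`** — B-p02's (E-DEC) heads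
  with `htemp` and `hsum` REMOVED from the binders (only the structural data, `hB` — any proof, e.g. `hB_C0` — and `2 < N` remain).

HC_CM is proved only modulo the 7 printed citations until rung 0 closes; nothing here is about Hodge classes.

References: A. Weil, *Sur la formule de Siegel dans la théorie des groupes classiques*, Acta Math. 113 (1965), Chap. I n° 2 Prop. 2 p. 8,
Chap. IV n° 40 Thm. 1 p. 57, n° 41 (34)–(35) p. 59 [Weil1965].
-/

set_option autoImplicit false

noncomputable section

open scoped Matrix Kronecker
open NumberField MeasureTheory
open Literature.RepresentationTheory.HeisenbergGroup Literature.RepresentationTheory.HeisenbergGroup.SymplecticMatrix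
open Literature.NumberTheory.Weil1964 Literature.NumberTheory.Weil1965 Literature.NumberTheory.Automorphic
open Literature.NumberTheory.GelbartRogawski1991 Literature.NumberTheory.GelbartRogawski1991.UnitaryDualPair
open Summit.HodgeConjecture.HodgeConjecture.Cruxes.H413
open Summit.HodgeConjecture.HodgeConjecture.Cruxes.H413.E2SWEisDecomposition

set_option linter.dupNamespace false

namespace Summit.HodgeConjecture.HodgeConjecture.Cruxes.H413.E2SWEisDecompositionCM

/-! ## §1 The matrix `C₀ = reindex (𝕋_F ⊕ −d 𝕋_F⁻¹)`: symmetric, non-degenerate; `4 < n + n` -/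

/-- `𝕋_F = reindex e e (T_V ⊗ₖ T_W)` is symmetric when `T_V`, `T_W` are. [cite: GelbartRogawski1991, §3.1 p. 454] -/
theorem isSymm_gram (F : Type) [Field F] [NumberField F] {N M n : ℕ} (e : Fin N × Fin M ≃ Fin n)
    {TV : Matrix (Fin N) (Fin N) F} {TW : Matrix (Fin M) (Fin M) F} (hV : TV.IsSymm) (hW : TW.IsSymm) :
    (gram F e TV TW).IsSymm := by
  have hk : (TV ⊗ₖ TW).IsSymm := by
    unfold Matrix.IsSymm
    rw [← Matrix.kroneckerMap_transpose, hV.eq, hW.eq]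
  rw [gram, Matrix.reindex_apply]
  exact hk.submatrix _

/-- **`C₀` is symmetric.** [cite: Weil1965, Chap. IV n° 41, p. 59] -/
theorem isSymm_C0 (F : Type) [Field F] [NumberField F] {N n : ℕ} (e : Fin N × Fin 1 ≃ Fin n)
    {TV : Matrix (Fin N) (Fin N) F} {TW : Matrix (Fin 1) (Fin 1) F} (hV : TV.IsSymm) (hW : TW.IsSymm) (d : F) :
    (Matrix.reindex finSumFinEquiv finSumFinEquiv (Matrix.fromBlocks (gram F e TV TW) 0 0 (-(d • (gram F e TV TW)⁻¹)))).IsSymm := by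
  have hT := isSymm_gram F e hV hW
  have hTinv : ((gram F e TV TW)⁻¹).IsSymm := by
    unfold Matrix.IsSymm at hT ⊢
    rw [Matrix.transpose_nonsing_inv, hT]
  have hblocks : (Matrix.fromBlocks (gram F e TV TW) 0 0 (-(d • (gram F e TV TW)⁻¹))).IsSymm :=
    Matrix.IsSymm.fromBlocks hT (by rw [Matrix.transpose_zero]) (hTinv.smul d).neg
  rw [Matrix.reindex_apply]
  exact hblocks.submatrix _

/-- `d ≠ 0` when `δ² = d` and `δ ≠ 0`. [folklore] -/
private theorem d_ne_zero {F E : Type} [Field F] [Field E] [Algebra F E] {δ : E} (hδ : δ ≠ 0) {d : F}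
    (hd : δ * δ = algebraMap F E d) : d ≠ 0 := by
  rintro rfl
  rw [map_zero, mul_self_eq_zero] at hd
  exact hδ hd

/-- **`det C₀ ≠ 0`** (`det 𝕋_F` a unit, `d ≠ 0`). [cite: Weil1965, Chap. IV n° 41, p. 59] -/
theorem det_C0_ne_zero (F E : Type) [Field F] [NumberField F] [Field E] [Algebra F E] {N n : ℕ} (e : Fin N × Fin 1 ≃ Fin n)
    {TV : Matrix (Fin N) (Fin N) F} {TW : Matrix (Fin 1) (Fin 1) F} (hVd : IsUnit TV.det) (hWd : IsUnit TW.det)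
    {δ : E} (hδ : δ ≠ 0) {d : F} (hd : δ * δ = algebraMap F E d) :
    (Matrix.reindex finSumFinEquiv finSumFinEquiv (Matrix.fromBlocks (gram F e TV TW) 0 0 (-(d • (gram F e TV TW)⁻¹)))).det ≠ 0 := by
  have hT : IsUnit (gram F e TV TW).det := isUnit_det_gram F e hVd hWd
  have hd0 : d ≠ 0 := d_ne_zero hδ hd
  rw [Matrix.det_reindex_self, Matrix.det_fromBlocks_zero₁₂, Matrix.det_neg, Matrix.det_smul]
  refine mul_ne_zero hT.ne_zero (mul_ne_zero (pow_ne_zero _ (neg_ne_zero.2 one_ne_zero)) (mul_ne_zero (pow_ne_zero _ hd0) ?_))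
  exact (Matrix.isUnit_nonsing_inv_det _ hT).ne_zero

/-- `n = N` for `e : Fin N × Fin 1 ≃ Fin n`, hence **`4 < n + n`** in Weil's range `2 < N`. [folklore] -/
theorem four_lt_card {N n : ℕ} (e : Fin N × Fin 1 ≃ Fin n) (hN : 2 < N) : 4 < n + n := by
  have h : N * 1 = n := by simpa only [Fintype.card_prod, Fintype.card_fin] using Fintype.card_congr e
  omega

/-! ## §2 Condition (B), temperedness and summability at `h = q_{C₀}` -/

/-- **WEIL'S CONDITION (B) FOR `h = q_{C₀}`** on `𝒮(X□)`, `F` totally real, `2 < N` (★ `summable_norm_adelicSiegelCoeff_sdForm`).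
[cite: Weil1965, Chap. IV n° 40 Thm. 1, p. 57; n° 41, p. 59] -/
theorem hB_C0 (F E : Type) [Field F] [NumberField F] [IsTotallyReal F] [Field E] [Algebra F E] {N n : ℕ} (e : Fin N × Fin 1 ≃ Fin n)
    {TV : Matrix (Fin N) (Fin N) F} {TW : Matrix (Fin 1) (Fin 1) F} (hV : TV.IsSymm) (hW : TW.IsSymm) (hVd : IsUnit TV.det) (hWd : IsUnit TW.det)
    {δ : E} (hδ : δ ≠ 0) {d : F} (hd : δ * δ = algebraMap F E d) (hN : 2 < N)
    [MeasurableSpace (adeleQuotient F)] [BorelSpace (adeleQuotient F)]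
    [MeasurableSpace (AdeleRing (𝓞 F) F)] [BorelSpace (AdeleRing (𝓞 F) F)] (ν : Measure (Fin (n + n) → (AdeleRing (𝓞 F) F))) [ν.IsAddHaarMeasure] :
    ∀ Φ ∈ piSchwartzBruhat F (Fin (n + n)),
      Summable fun ξ : F => ‖adelicSiegelCoeff F (Fin (n + n)) ν (sdForm F (Literature.NumberTheory.Weil1964.ratMatrix F (Matrix.reindex finSumFinEquiv finSumFinEquiv (Matrix.fromBlocks (gram F e TV TW) 0 0 (-(d • (gram F e TV TW)⁻¹)))))) Φ ξ‖ :=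
  fun _ hΦ => summable_norm_adelicSiegelCoeff_sdForm F ν (four_lt_card e hN) (isSymm_C0 F e hV hW d) (det_C0_ne_zero F E e hVd hWd hδ hd) hΦ

/-- **TEMPEREDNESS OF `E_X` FOR `h = q_{C₀}`**, for ANY proof `hB` of condition (B): every `Ψ ∈ 𝒮_ℝ(X□)` is `ν₀`-integrable with
`∫ Ψ dν₀ = E_X(Ψ)` (★ `integral_adelicSiegelMeasure_sdForm_eq_of_mem`) — the hypothesis `htemp` of ★ `E2SWEisDecomposition`.
[cite: Weil1965, Chap. IV n° 41, (35) p. 59] -/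
theorem htemp_C0 (F E : Type) [Field F] [NumberField F] [IsTotallyReal F] [Field E] [Algebra F E] {N n : ℕ} (e : Fin N × Fin 1 ≃ Fin n)
    {TV : Matrix (Fin N) (Fin N) F} {TW : Matrix (Fin 1) (Fin 1) F} (hV : TV.IsSymm) (hW : TW.IsSymm) (hVd : IsUnit TV.det) (hWd : IsUnit TW.det)
    {δ : E} (hδ : δ ≠ 0) {d : F} (hd : δ * δ = algebraMap F E d) (hN : 2 < N)
    [MeasurableSpace (adeleQuotient F)] [BorelSpace (adeleQuotient F)]
    [MeasurableSpace (AdeleRing (𝓞 F) F)] [BorelSpace (AdeleRing (𝓞 F) F)] (ν : Measure (Fin (n + n) → (AdeleRing (𝓞 F) F))) [ν.IsAddHaarMeasure]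
    (hB : ∀ Φ ∈ piSchwartzBruhat F (Fin (n + n)),
      Summable fun ξ : F => ‖adelicSiegelCoeff F (Fin (n + n)) ν (sdForm F (Literature.NumberTheory.Weil1964.ratMatrix F (Matrix.reindex finSumFinEquiv finSumFinEquiv (Matrix.fromBlocks (gram F e TV TW) 0 0 (-(d • (gram F e TV TW)⁻¹)))))) Φ ξ‖)
    (Ψr : piSchwartzBruhatReal F (Fin (n + n))) :
    Integrable (Ψr : (Fin (n + n) → (AdeleRing (𝓞 F) F)) → ℝ)
        (adelicSiegelMeasure F (Fin (n + n)) ν (sdForm F (Literature.NumberTheory.Weil1964.ratMatrix F (Matrix.reindex finSumFinEquiv finSumFinEquiv (Matrix.fromBlocks (gram F e TV TW) 0 0 (-(d • (gram F e TV TW)⁻¹)))))) (continuous_sdForm F _) hB) ∧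
      ∫ x, (Ψr : (Fin (n + n) → (AdeleRing (𝓞 F) F)) → ℝ) x
          ∂(adelicSiegelMeasure F (Fin (n + n)) ν (sdForm F (Literature.NumberTheory.Weil1964.ratMatrix F (Matrix.reindex finSumFinEquiv finSumFinEquiv (Matrix.fromBlocks (gram F e TV TW) 0 0 (-(d • (gram F e TV TW)⁻¹)))))) (continuous_sdForm F _) hB) =
        adelicSiegelFunctional F (Fin (n + n)) ν (sdForm F (Literature.NumberTheory.Weil1964.ratMatrix F (Matrix.reindex finSumFinEquiv finSumFinEquiv (Matrix.fromBlocks (gram F e TV TW) 0 0 (-(d • (gram F e TV TW)⁻¹)))))) (continuous_sdForm F _) hB Ψr :=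
  integral_adelicSiegelMeasure_sdForm_eq_of_mem F ν (four_lt_card e hN) (isSymm_C0 F e hV hW d) (det_C0_ne_zero F E e hVd hWd hδ hd)
    (continuous_sdForm F _) hB Ψr

/-- **THE EISENSTEIN SECTION IS SUMMABLE** for every `Ψ ∈ 𝒮(X□)`, `F` totally real, `2 < N`: condition (B) for `q_{C₀}` (`hB_C0`) through
★ `E2SWEisFourierSide.summable_eisSection_iff_summable_siegelCoeff` — the hypothesis `hsum` of ★ `E2SWEisDecomposition`, DISCHARGED.
[cite: Weil1965, Chap. IV n° 40 Thm. 1, p. 57] [cite: Weil1965, n° 39 (30) p. 55] -/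
theorem summable_eisSection_of_isTotallyReal (F E : Type) [Field F] [NumberField F] [Field E] [NumberField E] [Algebra F E]
    (c : E ≃ₐ[F] E) (N : ℕ) {n : ℕ} (e : Fin N × Fin 1 ≃ Fin n)
    {TV : Matrix (Fin N) (Fin N) F} {TW : Matrix (Fin 1) (Fin 1) F}
    [Algebra.IsQuadraticExtension F E] [IsTotallyReal F] {δ : E} (hcδ : c δ = -δ) (hδ : δ ≠ 0) {d : F}
    (hd : δ * δ = algebraMap F E d) (hV : TV.IsSymm) (hW : TW.IsSymm) (hVd : IsUnit TV.det) (hWd : IsUnit TW.det)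
    [LocallyCompactSpace (UnitaryGroup.adelic F E c N (TV.map (algebraMap F E)))]
    [LocallyCompactSpace (UnitaryGroup.adelic F E c 1 (TW.map (algebraMap F E)))]
    (s : UnitaryGroup.adelicPair F E c N 1 (TV.map (algebraMap F E)) (TW.map (algebraMap F E)) →*
      adelicMpCont F (Fin n) (adelicGram F e TV TW))
    (hs : (splittingDatum F E c N 1 e (TV.map (algebraMap F E)) (TW.map (algebraMap F E)) hcδ hδ hd hV hW hVd hWd rfl rfl).IsCompatible s)
    (hN : 2 < N)
    [MeasurableSpace (adeleQuotient F)] [BorelSpace (adeleQuotient F)]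
    [MeasurableSpace (AdeleRing (𝓞 F) F)] [BorelSpace (AdeleRing (𝓞 F) F)] (ν : Measure (Fin (n + n) → (AdeleRing (𝓞 F) F))) [ν.IsAddHaarMeasure]
    (hν : ν (piFundamentalDomain F (Fin (n + n))) = 1)
    (Ψ : piSchwartzBruhat F (Fin (n + n))) :
    Summable fun q : (((symplecticGroup (polar (adelicForm F (Fin (n + n)) (adelicGram F (((Equiv.prodCongr (Equiv.refl (Fin N)) finSumFinEquiv.symm).trans (Equiv.prodSumDistrib (Fin N) (Fin 1) (Fin 1))).trans ((Equiv.sumCongr e e).trans finSumFinEquiv)) TV (Matrix.reindex finSumFinEquiv finSumFinEquiv (Matrix.fromBlocks TW 0 0 (-TW))))))).subtype.comp ((toSp F E c N (1 + 1) (((Equiv.prodCongr (Equiv.refl (Fin N)) finSumFinEquiv.symm).trans (Equiv.prodSumDistrib (Fin N) (Fin 1) (Fin 1))).trans ((Equiv.sumCongr e e).trans finSumFinEquiv)) (TV.map (algebraMap F E)) ((Matrix.reindex finSumFinEquiv finSumFinEquiv (Matrix.fromBlocks TW 0 0 (-TW))).map (algebraMap F E)) hcδ hδ hd hV (E2SWOrbit.twd_isSymm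 F TW hW) rfl rfl).comp ((UnitaryGroup.adelicInr F E c N (1 + 1) (TV.map (algebraMap F E)) ((Matrix.reindex finSumFinEquiv finSumFinEquiv (Matrix.fromBlocks TW 0 0 (-TW))).map (algebraMap F E))).comp (UnitaryGroup.toAdelic F E c (1 + 1) ((Matrix.reindex finSumFinEquiv finSumFinEquiv (Matrix.fromBlocks TW 0 0 (-TW))).map (algebraMap F E)))))).range.comap ((symplecticGroup (polar (adelicForm F (Fin (n + n)) (doubledGramFin F (adelicGram F e TV TW))))).subtype.comp (ratSp F (doubledGramFin F (adelicGram F e TV TW)) (isUnit_det_doubledGramFin F _ (isUnit_det_adelicGram F e hVd hWd))))) ⧸ (((siegelParabolicPi (doubledGramFin F (adelicGram F e TV TW))).comap (ratSp F (doubledGramFin F (adelicGram F e TV TW)) (isUnit_det_doubledGramFin F _ (isUnit_det_adelicGram F e hVd hWd)))).comap (MulAut.conj (doublingDeltaRat F (n := n))).toMonoidHom).subgroupOf (((symplecticGroup (polar (adelicForm F (Fin (n + n)) (adelicGram F (((Equiv.prodCongr (Equiv.refl (Fin N)) finSumFinEquiv.symm).trans (Equiv.prodSumDistrib (Fin N)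 (Fin 1) (Fin 1))).trans ((Equiv.sumCongr e e).trans finSumFinEquiv)) TV (Matrix.reindex finSumFinEquiv finSumFinEquiv (Matrix.fromBlocks TW 0 0 (-TW))))))).subtype.comp ((toSp F E c N (1 + 1) (((Equiv.prodCongr (Equiv.refl (Fin N)) finSumFinEquiv.symm).trans (Equiv.prodSumDistrib (Fin N) (Fin 1) (Fin 1))).trans ((Equiv.sumCongr e e).trans finSumFinEquiv)) (TV.map (algebraMap F E)) ((Matrix.reindex finSumFinEquiv finSumFinEquiv (Matrix.fromBlocks TW 0 0 (-TW))).map (algebraMap F E)) hcδ hδ hd hV (E2SWOrbit.twd_isSymm F TW hW) rfl rfl).comp ((UnitaryGroup.adelicInr F E c N (1 + 1) (TV.map (algebraMap F E)) ((Matrix.reindex finSumFinEquiv finSumFinEquiv (Matrix.fromBlocks TW 0 0 (-TW))).map (algebraMap F E))).comp (UnitaryGroup.toAdelic F E c (1 + 1) ((Matrix.reindex finSumFinEquiv finSumFinEquiv (Matrix.fromBlocks TW 0 0 (-TW))).map (algebraMap F E)))))).range.comap ((symplecticGroup (polar (adelicForm F (Fin (n + n)) (doubledGramFin F (adelicGram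 F e TV TW))))).subtype.comp (ratSp F (doubledGramFin F (adelicGram F e TV TW)) (isUnit_det_doubledGramFin F _ (isUnit_det_adelicGram F e hVd hWd))))) =>
      ((adelicMpCont.omega F (Fin (n + n)) (doubledGramFin F (adelicGram F e TV TW)) (doublingDeltaLift F (adelicGram F e TV TW) (isUnit_det_adelicGram F e hVd hWd)) (adelicMpCont.omega F (Fin (n + n)) (doubledGramFin F (adelicGram F e TV TW)) (ratThetaLiftCont F (doubledGramFin F (adelicGram F e TV TW)) (isUnit_det_doubledGramFin F _ (isUnit_det_adelicGram F e hVd hWd)) ((Quotient.out q : (((symplecticGroup (polar (adelicForm F (Fin (n + n)) (adelicGram F (((Equiv.prodCongr (Equiv.refl (Fin N)) finSumFinEquiv.symm).trans (Equiv.prodSumDistrib (Fin N) (Fin 1) (Fin 1))).trans ((Equiv.sumCongr e e).trans finSumFinEquiv)) TV (Matrix.reindex finSumFinEquiv finSumFinEquiv (Matrix.fromBlocks TW 0 0 (-TW))))))).subtype.comp ((toSp F E c N (1 + 1) (((Equiv.prodCongr (Equiv.refl (Fin N)) finSumFinEquiv.symm).trans (Equiv.prodSumDistrib (Fin N) (Fin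 1) (Fin 1))).trans ((Equiv.sumCongr e e).trans finSumFinEquiv)) (TV.map (algebraMap F E)) ((Matrix.reindex finSumFinEquiv finSumFinEquiv (Matrix.fromBlocks TW 0 0 (-TW))).map (algebraMap F E)) hcδ hδ hd hV (E2SWOrbit.twd_isSymm F TW hW) rfl rfl).comp ((UnitaryGroup.adelicInr F E c N (1 + 1) (TV.map (algebraMap F E)) ((Matrix.reindex finSumFinEquiv finSumFinEquiv (Matrix.fromBlocks TW 0 0 (-TW))).map (algebraMap F E))).comp (UnitaryGroup.toAdelic F E c (1 + 1) ((Matrix.reindex finSumFinEquiv finSumFinEquiv (Matrix.fromBlocks TW 0 0 (-TW))).map (algebraMap F E)))))).range.comap ((symplecticGroup (polar (adelicForm F (Fin (n + n)) (doubledGramFin F (adelicGram F e TV TW))))).subtype.comp (ratSp F (doubledGramFin F (adelicGram F e TV TW)) (isUnit_det_doubledGramFin F _ (isUnit_det_adelicGram F e hVd hWd)))))) : Matrix.symplecticGroup (Fin (n + n)) F)⁻¹) Ψ) :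
          piSchwartzBruhat F (Fin (n + n))) : (Fin (n + n) → (AdeleRing (𝓞 F) F)) → ℂ) 0 :=
  (E2SWEisFourierSide.summable_eisSection_iff_summable_siegelCoeff F E c N e hcδ hδ hd hV hW hVd hWd s hs hN ν hν Ψ).2
    (hB_C0 F E e hV hW hVd hWd hδ hd hN ν _
      ((geomFrame F (adelicGram F e TV TW) (isUnit_det_adelicGram F e hVd hWd) Ψ : piSchwartzBruhat F (Fin (n + n)))).2).of_norm

/-! ## §3 (E-DEC) with `htemp` and `hsum` discharged -/

/-- **(E-DEC) FOR A TOTALLY REAL `F`, HYPOTHESES DISCHARGED**: `eis … Ψ = Ψ♮(0) + Σ'_{b ∈ F} ∫ Ψ♮ dμ_b`, `μ_b = adelicSiegelFibreMeasure ν q_{C₀} … b`,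
for EVERY `Ψ ∈ 𝒮(X□)` and ANY proof `hB` of condition (B) (e.g. `hB_C0`); no `htemp`, no `hsum` (★ `E2SWEisDecomposition.eis_eq_geomFrame_zero_add_tsum_integral_fibre`
fed with `htemp_C0` and `summable_eisSection_of_isTotallyReal`). [cite: Weil1965, Chap. IV n° 41, (35) p. 59] [cite: Weil1965, n° 46 p. 66] -/
theorem eis_eq_geomFrame_zero_add_tsum_integral_fibre_of_isTotallyReal (F E : Type) [Field F] [NumberField F] [Field E] [NumberField E] [Algebra F E]
    (c : E ≃ₐ[F] E) (N : ℕ) {n : ℕ} (e : Fin N × Fin 1 ≃ Fin n)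
    {TV : Matrix (Fin N) (Fin N) F} {TW : Matrix (Fin 1) (Fin 1) F}
    [Algebra.IsQuadraticExtension F E] [IsTotallyReal F] {δ : E} (hcδ : c δ = -δ) (hδ : δ ≠ 0) {d : F}
    (hd : δ * δ = algebraMap F E d) (hV : TV.IsSymm) (hW : TW.IsSymm) (hVd : IsUnit TV.det) (hWd : IsUnit TW.det)
    [LocallyCompactSpace (UnitaryGroup.adelic F E c N (TV.map (algebraMap F E)))]
    [LocallyCompactSpace (UnitaryGroup.adelic F E c 1 (TW.map (algebraMap F E)))]
    (s : UnitaryGroup.adelicPair F E c N 1 (TV.map (algebraMap F E)) (TW.map (algebraMap F E)) →*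
      adelicMpCont F (Fin n) (adelicGram F e TV TW))
    (hs : (splittingDatum F E c N 1 e (TV.map (algebraMap F E)) (TW.map (algebraMap F E)) hcδ hδ hd hV hW hVd hWd rfl rfl).IsCompatible s)
    (hN : 2 < N)
    [MeasurableSpace (adeleQuotient F)] [BorelSpace (adeleQuotient F)]
    [MeasurableSpace (AdeleRing (𝓞 F) F)] [BorelSpace (AdeleRing (𝓞 F) F)] (ν : Measure (Fin (n + n) → (AdeleRing (𝓞 F) F))) [ν.IsAddHaarMeasure]
    (hν : ν (piFundamentalDomain F (Fin (n + n))) = 1)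
    (hB : ∀ Φ ∈ piSchwartzBruhat F (Fin (n + n)),
      Summable fun ξ : F => ‖adelicSiegelCoeff F (Fin (n + n)) ν (sdForm F (Literature.NumberTheory.Weil1964.ratMatrix F (Matrix.reindex finSumFinEquiv finSumFinEquiv (Matrix.fromBlocks (gram F e TV TW) 0 0 (-(d • (gram F e TV TW)⁻¹)))))) Φ ξ‖)
    (Ψ : piSchwartzBruhat F (Fin (n + n))) :
    ∑' q : (((symplecticGroup (polar (adelicForm F (Fin (n + n)) (adelicGram F (((Equiv.prodCongr (Equiv.refl (Fin N)) finSumFinEquiv.symm).trans (Equiv.prodSumDistrib (Fin N) (Fin 1) (Fin 1))).trans ((Equiv.sumCongr e e).trans finSumFinEquiv)) TV (Matrix.reindex finSumFinEquiv finSumFinEquiv (Matrix.fromBlocks TW 0 0 (-TW))))))).subtype.comp ((toSp F E c N (1 + 1) (((Equiv.prodCongr (Equiv.refl (Fin N)) finSumFinEquiv.symm).trans (Equiv.prodSumDistrib (Fin N) (Fin 1) (Fin 1))).trans ((Equiv.sumCongr e e).trans finSumFinEquiv)) (TV.map (algebraMap F E)) ((Matrix.reindex finSumFinEquiv finSumFinEquiv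 (Matrix.fromBlocks TW 0 0 (-TW))).map (algebraMap F E)) hcδ hδ hd hV (E2SWOrbit.twd_isSymm F TW hW) rfl rfl).comp ((UnitaryGroup.adelicInr F E c N (1 + 1) (TV.map (algebraMap F E)) ((Matrix.reindex finSumFinEquiv finSumFinEquiv (Matrix.fromBlocks TW 0 0 (-TW))).map (algebraMap F E))).comp (UnitaryGroup.toAdelic F E c (1 + 1) ((Matrix.reindex finSumFinEquiv finSumFinEquiv (Matrix.fromBlocks TW 0 0 (-TW))).map (algebraMap F E)))))).range.comap ((symplecticGroup (polar (adelicForm F (Fin (n + n)) (doubledGramFin F (adelicGram F e TV TW))))).subtype.comp (ratSp F (doubledGramFin F (adelicGram F e TV TW)) (isUnit_det_doubledGramFin F _ (isUnit_det_adelicGram F e hVd hWd))))) ⧸ (((siegelParabolicPi (doubledGramFin F (adelicGram F e TV TW))).comap (ratSp F (doubledGramFin F (adelicGram F e TV TW)) (isUnit_det_doubledGramFin F _ (isUnit_det_adelicGram F e hVd hWd)))).comap (MulAut.conj (doublingDeltaRat F (n := n))).toMonoidHom).subgroupOf (((symplecticGroup (polar (adelicForm F (Fin (n + n)) (adelicGram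 F (((Equiv.prodCongr (Equiv.refl (Fin N)) finSumFinEquiv.symm).trans (Equiv.prodSumDistrib (Fin N) (Fin 1) (Fin 1))).trans ((Equiv.sumCongr e e).trans finSumFinEquiv)) TV (Matrix.reindex finSumFinEquiv finSumFinEquiv (Matrix.fromBlocks TW 0 0 (-TW))))))).subtype.comp ((toSp F E c N (1 + 1) (((Equiv.prodCongr (Equiv.refl (Fin N)) finSumFinEquiv.symm).trans (Equiv.prodSumDistrib (Fin N) (Fin 1) (Fin 1))).trans ((Equiv.sumCongr e e).trans finSumFinEquiv)) (TV.map (algebraMap F E)) ((Matrix.reindex finSumFinEquiv finSumFinEquiv (Matrix.fromBlocks TW 0 0 (-TW))).map (algebraMap F E)) hcδ hδ hd hV (E2SWOrbit.twd_isSymm F TW hW) rfl rfl).comp ((UnitaryGroup.adelicInr F E c N (1 + 1) (TV.map (algebraMap F E)) ((Matrix.reindex finSumFinEquiv finSumFinEquiv (Matrix.fromBlocks TW 0 0 (-TW))).map (algebraMap F E))).comp (UnitaryGroup.toAdelic F E c (1 + 1) ((Matrix.reindex finSumFinEquiv finSumFinEquiv (Matrix.fromBlocks TW 0 0 (-TW))).map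 (algebraMap F E)))))).range.comap ((symplecticGroup (polar (adelicForm F (Fin (n + n)) (doubledGramFin F (adelicGram F e TV TW))))).subtype.comp (ratSp F (doubledGramFin F (adelicGram F e TV TW)) (isUnit_det_doubledGramFin F _ (isUnit_det_adelicGram F e hVd hWd))))),
        ((adelicMpCont.omega F (Fin (n + n)) (doubledGramFin F (adelicGram F e TV TW)) (doublingDeltaLift F (adelicGram F e TV TW) (isUnit_det_adelicGram F e hVd hWd)) (adelicMpCont.omega F (Fin (n + n)) (doubledGramFin F (adelicGram F e TV TW)) (ratThetaLiftCont F (doubledGramFin F (adelicGram F e TV TW)) (isUnit_det_doubledGramFin F _ (isUnit_det_adelicGram F e hVd hWd)) ((Quotient.out q : (((symplecticGroup (polar (adelicForm F (Fin (n + n)) (adelicGram F (((Equiv.prodCongr (Equiv.refl (Fin N)) finSumFinEquiv.symm).trans (Equiv.prodSumDistrib (Fin N) (Fin 1) (Fin 1))).trans ((Equiv.sumCongr e e).trans finSumFinEquiv)) TV (Matrix.reindex finSumFinEquiv finSumFinEquiv (Matrix.fromBlocks TW 0 0 (-TW))))))).subtype.comp ((toSp F E c N (1 + 1) (((Equiv.prodCongr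 (Equiv.refl (Fin N)) finSumFinEquiv.symm).trans (Equiv.prodSumDistrib (Fin N) (Fin 1) (Fin 1))).trans ((Equiv.sumCongr e e).trans finSumFinEquiv)) (TV.map (algebraMap F E)) ((Matrix.reindex finSumFinEquiv finSumFinEquiv (Matrix.fromBlocks TW 0 0 (-TW))).map (algebraMap F E)) hcδ hδ hd hV (E2SWOrbit.twd_isSymm F TW hW) rfl rfl).comp ((UnitaryGroup.adelicInr F E c N (1 + 1) (TV.map (algebraMap F E)) ((Matrix.reindex finSumFinEquiv finSumFinEquiv (Matrix.fromBlocks TW 0 0 (-TW))).map (algebraMap F E))).comp (UnitaryGroup.toAdelic F E c (1 + 1) ((Matrix.reindex finSumFinEquiv finSumFinEquiv (Matrix.fromBlocks TW 0 0 (-TW))).map (algebraMap F E)))))).range.comap ((symplecticGroup (polar (adelicForm F (Fin (n + n)) (doubledGramFin F (adelicGram F e TV TW))))).subtype.comp (ratSp F (doubledGramFin F (adelicGram F e TV TW)) (isUnit_det_doubledGramFin F _ (isUnit_det_adelicGram F e hVd hWd)))))) : Matrix.symplecticGroup (Fin (n + n)) F)⁻¹) Ψ) :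
          piSchwartzBruhat F (Fin (n + n))) : (Fin (n + n) → (AdeleRing (𝓞 F) F)) → ℂ) 0 =
      (((geomFrame F (adelicGram F e TV TW) (isUnit_det_adelicGram F e hVd hWd) Ψ : piSchwartzBruhat F (Fin (n + n)))) : (Fin (n + n) → (AdeleRing (𝓞 F) F)) → ℂ) 0 +
        ∑' b : F, ∫ x, (((geomFrame F (adelicGram F e TV TW) (isUnit_det_adelicGram F e hVd hWd) Ψ : piSchwartzBruhat F (Fin (n + n)))) : (Fin (n + n) → (AdeleRing (𝓞 F) F)) → ℂ) x
          ∂(adelicSiegelFibreMeasure F (Fin (n + n)) ν (sdForm F (Literature.NumberTheory.Weil1964.ratMatrix F (Matrix.reindex finSumFinEquiv finSumFinEquiv (Matrix.fromBlocks (gram F e TV TW) 0 0 (-(d • (gram F e TV TW)⁻¹))))))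
            (continuous_sdForm F _) hB b) :=
  eis_eq_geomFrame_zero_add_tsum_integral_fibre F E c N e hcδ hδ hd hV hW hVd hWd s hs hN ν hν hB
    (htemp_C0 F E e hV hW hVd hWd hδ hd hN ν hB) Ψ
    (summable_eisSection_of_isTotallyReal F E c N e hcδ hδ hd hV hW hVd hWd s hs hN ν hν Ψ)

/-- **(E-DEC), `HasSum` form, for a totally real `F`, hypotheses discharged**: `HasSum (b ↦ ∫ Ψ♮ dμ_b) (E(Ψ) − Ψ♮(0))`.
[cite: Weil1965, Chap. IV n° 41, (35) p. 59] -/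
theorem hasSum_integral_fibre_of_isTotallyReal (F E : Type) [Field F] [NumberField F] [Field E] [NumberField E] [Algebra F E]
    (c : E ≃ₐ[F] E) (N : ℕ) {n : ℕ} (e : Fin N × Fin 1 ≃ Fin n)
    {TV : Matrix (Fin N) (Fin N) F} {TW : Matrix (Fin 1) (Fin 1) F}
    [Algebra.IsQuadraticExtension F E] [IsTotallyReal F] {δ : E} (hcδ : c δ = -δ) (hδ : δ ≠ 0) {d : F}
    (hd : δ * δ = algebraMap F E d) (hV : TV.IsSymm) (hW : TW.IsSymm) (hVd : IsUnit TV.det) (hWd : IsUnit TW.det)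
    [LocallyCompactSpace (UnitaryGroup.adelic F E c N (TV.map (algebraMap F E)))]
    [LocallyCompactSpace (UnitaryGroup.adelic F E c 1 (TW.map (algebraMap F E)))]
    (s : UnitaryGroup.adelicPair F E c N 1 (TV.map (algebraMap F E)) (TW.map (algebraMap F E)) →*
      adelicMpCont F (Fin n) (adelicGram F e TV TW))
    (hs : (splittingDatum F E c N 1 e (TV.map (algebraMap F E)) (TW.map (algebraMap F E)) hcδ hδ hd hV hW hVd hWd rfl rfl).IsCompatible s)
    (hN : 2 < N)
    [MeasurableSpace (adeleQuotient F)] [BorelSpace (adeleQuotient F)]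
    [MeasurableSpace (AdeleRing (𝓞 F) F)] [BorelSpace (AdeleRing (𝓞 F) F)] (ν : Measure (Fin (n + n) → (AdeleRing (𝓞 F) F))) [ν.IsAddHaarMeasure]
    (hν : ν (piFundamentalDomain F (Fin (n + n))) = 1)
    (hB : ∀ Φ ∈ piSchwartzBruhat F (Fin (n + n)),
      Summable fun ξ : F => ‖adelicSiegelCoeff F (Fin (n + n)) ν (sdForm F (Literature.NumberTheory.Weil1964.ratMatrix F (Matrix.reindex finSumFinEquiv finSumFinEquiv (Matrix.fromBlocks (gram F e TV TW) 0 0 (-(d • (gram F e TV TW)⁻¹)))))) Φ ξ‖)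
    (Ψ : piSchwartzBruhat F (Fin (n + n))) :
    HasSum (fun b : F => ∫ x, (((geomFrame F (adelicGram F e TV TW) (isUnit_det_adelicGram F e hVd hWd) Ψ : piSchwartzBruhat F (Fin (n + n)))) : (Fin (n + n) → (AdeleRing (𝓞 F) F)) → ℂ) x
          ∂(adelicSiegelFibreMeasure F (Fin (n + n)) ν (sdForm F (Literature.NumberTheory.Weil1964.ratMatrix F (Matrix.reindex finSumFinEquiv finSumFinEquiv (Matrix.fromBlocks (gram F e TV TW) 0 0 (-(d • (gram F e TV TW)⁻¹))))))
            (continuous_sdForm F _) hB b))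
      (∑' q : (((symplecticGroup (polar (adelicForm F (Fin (n + n)) (adelicGram F (((Equiv.prodCongr (Equiv.refl (Fin N)) finSumFinEquiv.symm).trans (Equiv.prodSumDistrib (Fin N) (Fin 1) (Fin 1))).trans ((Equiv.sumCongr e e).trans finSumFinEquiv)) TV (Matrix.reindex finSumFinEquiv finSumFinEquiv (Matrix.fromBlocks TW 0 0 (-TW))))))).subtype.comp ((toSp F E c N (1 + 1) (((Equiv.prodCongr (Equiv.refl (Fin N)) finSumFinEquiv.symm).trans (Equiv.prodSumDistrib (Fin N) (Fin 1) (Fin 1))).trans ((Equiv.sumCongr e e).trans finSumFinEquiv)) (TV.map (algebraMap F E)) ((Matrix.reindex finSumFinEquiv finSumFinEquiv (Matrix.fromBlocks TW 0 0 (-TW))).map (algebraMap F E)) hcδ hδ hd hV (E2SWOrbit.twd_isSymm F TW hW) rfl rfl).comp ((UnitaryGroup.adelicInr F E c N (1 + 1) (TV.map (algebraMap F E)) ((Matrix.reindex finSumFinEquiv finSumFinEquiv (Matrix.fromBlocks TW 0 0 (-TW))).map (algebraMap F E))).comp (UnitaryGroup.toAdelic F E c (1 + 1) ((Matrix.reindex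 finSumFinEquiv finSumFinEquiv (Matrix.fromBlocks TW 0 0 (-TW))).map (algebraMap F E)))))).range.comap ((symplecticGroup (polar (adelicForm F (Fin (n + n)) (doubledGramFin F (adelicGram F e TV TW))))).subtype.comp (ratSp F (doubledGramFin F (adelicGram F e TV TW)) (isUnit_det_doubledGramFin F _ (isUnit_det_adelicGram F e hVd hWd))))) ⧸ (((siegelParabolicPi (doubledGramFin F (adelicGram F e TV TW))).comap (ratSp F (doubledGramFin F (adelicGram F e TV TW)) (isUnit_det_doubledGramFin F _ (isUnit_det_adelicGram F e hVd hWd)))).comap (MulAut.conj (doublingDeltaRat F (n := n))).toMonoidHom).subgroupOf (((symplecticGroup (polar (adelicForm F (Fin (n + n)) (adelicGram F (((Equiv.prodCongr (Equiv.refl (Fin N)) finSumFinEquiv.symm).trans (Equiv.prodSumDistrib (Fin N) (Fin 1) (Fin 1))).trans ((Equiv.sumCongr e e).trans finSumFinEquiv)) TV (Matrix.reindex finSumFinEquiv finSumFinEquiv (Matrix.fromBlocks TW 0 0 (-TW))))))).subtype.comp ((toSp F E c N (1 + 1) (((Equiv.prodCongr (Equiv.refl (Fin N)) finSumFinEquiv.symm).trans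 (Equiv.prodSumDistrib (Fin N) (Fin 1) (Fin 1))).trans ((Equiv.sumCongr e e).trans finSumFinEquiv)) (TV.map (algebraMap F E)) ((Matrix.reindex finSumFinEquiv finSumFinEquiv (Matrix.fromBlocks TW 0 0 (-TW))).map (algebraMap F E)) hcδ hδ hd hV (E2SWOrbit.twd_isSymm F TW hW) rfl rfl).comp ((UnitaryGroup.adelicInr F E c N (1 + 1) (TV.map (algebraMap F E)) ((Matrix.reindex finSumFinEquiv finSumFinEquiv (Matrix.fromBlocks TW 0 0 (-TW))).map (algebraMap F E))).comp (UnitaryGroup.toAdelic F E c (1 + 1) ((Matrix.reindex finSumFinEquiv finSumFinEquiv (Matrix.fromBlocks TW 0 0 (-TW))).map (algebraMap F E)))))).range.comap ((symplecticGroup (polar (adelicForm F (Fin (n + n)) (doubledGramFin F (adelicGram F e TV TW))))).subtype.comp (ratSp F (doubledGramFin F (adelicGram F e TV TW)) (isUnit_det_doubledGramFin F _ (isUnit_det_adelicGram F e hVd hWd))))),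
          ((adelicMpCont.omega F (Fin (n + n)) (doubledGramFin F (adelicGram F e TV TW)) (doublingDeltaLift F (adelicGram F e TV TW) (isUnit_det_adelicGram F e hVd hWd)) (adelicMpCont.omega F (Fin (n + n)) (doubledGramFin F (adelicGram F e TV TW)) (ratThetaLiftCont F (doubledGramFin F (adelicGram F e TV TW)) (isUnit_det_doubledGramFin F _ (isUnit_det_adelicGram F e hVd hWd)) ((Quotient.out q : (((symplecticGroup (polar (adelicForm F (Fin (n + n)) (adelicGram F (((Equiv.prodCongr (Equiv.refl (Fin N)) finSumFinEquiv.symm).trans (Equiv.prodSumDistrib (Fin N) (Fin 1) (Fin 1))).trans ((Equiv.sumCongr e e).trans finSumFinEquiv)) TV (Matrix.reindex finSumFinEquiv finSumFinEquiv (Matrix.fromBlocks TW 0 0 (-TW))))))).subtype.comp ((toSp F E c N (1 + 1) (((Equiv.prodCongr (Equiv.refl (Fin N)) finSumFinEquiv.symm).trans (Equiv.prodSumDistrib (Fin N) (Fin 1) (Fin 1))).trans ((Equiv.sumCongr e e).trans finSumFinEquiv)) (TV.map (algebraMap F E)) ((Matrix.reindex finSumFinEquiv finSumFinEquiv (Matrix.fromBlocks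 TW 0 0 (-TW))).map (algebraMap F E)) hcδ hδ hd hV (E2SWOrbit.twd_isSymm F TW hW) rfl rfl).comp ((UnitaryGroup.adelicInr F E c N (1 + 1) (TV.map (algebraMap F E)) ((Matrix.reindex finSumFinEquiv finSumFinEquiv (Matrix.fromBlocks TW 0 0 (-TW))).map (algebraMap F E))).comp (UnitaryGroup.toAdelic F E c (1 + 1) ((Matrix.reindex finSumFinEquiv finSumFinEquiv (Matrix.fromBlocks TW 0 0 (-TW))).map (algebraMap F E)))))).range.comap ((symplecticGroup (polar (adelicForm F (Fin (n + n)) (doubledGramFin F (adelicGram F e TV TW))))).subtype.comp (ratSp F (doubledGramFin F (adelicGram F e TV TW)) (isUnit_det_doubledGramFin F _ (isUnit_det_adelicGram F e hVd hWd)))))) : Matrix.symplecticGroup (Fin (n + n)) F)⁻¹) Ψ) :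
          piSchwartzBruhat F (Fin (n + n))) : (Fin (n + n) → (AdeleRing (𝓞 F) F)) → ℂ) 0 -
        (((geomFrame F (adelicGram F e TV TW) (isUnit_det_adelicGram F e hVd hWd) Ψ : piSchwartzBruhat F (Fin (n + n)))) : (Fin (n + n) → (AdeleRing (𝓞 F) F)) → ℂ) 0) := by
  exact hasSum_integral_fibre F E c N e hcδ hδ hd hV hW hVd hWd s hs hN ν hν hB
    (htemp_C0 F E e hV hW hVd hWd hδ hd hN ν hB) Ψ
    (summable_eisSection_of_isTotallyReal F E c N e hcδ hδ hd hV hW hVd hWd s hs hN ν hν Ψ)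

end Summit.HodgeConjecture.HodgeConjecture.Cruxes.H413.E2SWEisDecompositionCM

end
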